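import Summits.Ventures.DiscreteObjects.Hadamard.ConferenceGraph333Order166
import Summits.Ventures.DiscreteObjects.Hadamard.ConferenceGraph333PGroupFixed

/-!
# Order 166: the two regular orbits are the neighbourhood and the non-neighbourhood of the fixed vertex (kernel)

Framing: lottery ticket; floor = certified bounds/negative ranges.  Cell pub-namedobj (venture DiscreteObjects),
target (H) = `H(668)`, hadamard gen 30.  Completes the kernel dictionary of the bicirculant family F-Z166
(`ConferenceGraph333Order166`, FAMILY-Z166.md): for an automorphism `σ` of order exactly `166` of an `srg(333,166,82,83)`
* `aut_order166_fixed_unique` — the fixed vertex `∞` of `σ` is unique and is the only fixed vertex of `σ²` and of `σ⁸³`;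
* `aut_order166_period` — every other vertex has `⟨σ⟩`-orbit of length exactly `166` (`k ↦ σ^k x` is injective on `[0,166)`):
  a repetition would make `x` periodic of period `gcd(d,166) ∈ {1,2,83}` (`Function.IsPeriodicPt.gcd`), i.e. a fixed point of
  `σ`, `σ²` or `σ⁸³`;
* **`aut_order166_two_orbits`** — hence `N(∞)` (which is `σ`-invariant of size `166`) is ONE orbit and so is its complement in
  `V ∖ {∞}`: for `x, y ≠ ∞` with `A ∞ x = A ∞ y` there is `k < 166` with `σ^k x = y`.  So the graph is `∞ + X + Y` with `ℤ/166`
  regular on `X = N(∞)` and on `Y`: exactly the two-circulant-cores structure of `C(334)` (FAMILY-Z166.md).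
WORDS: structure of a HYPOTHETICAL object; ours (PROVISIONAL).  No `sorry`, no new definitions.
-/

namespace Summit.Ventures.DiscreteObjects.Hadamard

open Finset

section order166orbits
variable {V : Type*} [Fintype V] [DecidableEq V]

omit [Fintype V] [DecidableEq V] in
/-- a finset of card `1` containing `a` is `{a}`-like: every member equals `a`. -/
theorem eq_of_mem_card_one {s : Finset V} (hs : s.card = 1) {a b : V} (ha : a ∈ s) (hb : b ∈ s) : b = a := by
  obtain ⟨z, hz⟩ := Finset.card_eq_one.mp hs
  rw [hz, Finset.mem_singleton] at ha hb
  rw [ha, hb]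

/-- **Uniqueness of the fixed vertex** of `σ`, `σ²`, `σ⁸³` for `σ` of order `166`. -/
theorem aut_order166_fixed_unique (hV : Fintype.card V = 333) (A : Matrix V V ℤ)
    (h01 : ∀ x y, A x y = 0 ∨ A x y = 1) (hsymm : ∀ x y, A y x = A x y) (hdiag : ∀ x, A x x = 0)
    (hk : ∀ x, ∑ y, A x y = 166) (hsrg : ∀ x y, ∑ z, A x z * A z y = 83 * (1 + (if x = y then 1 else 0)) - A x y)
    (σ : Equiv.Perm V) (hσ : σ ^ 166 = 1) (hσ83 : σ ^ 83 ≠ 1) (hσ2 : σ ^ 2 ≠ 1) (hA : ∀ x y, A (σ x) (σ y) = A x y) :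
    ∃ inf : V, σ inf = inf ∧ (∀ x, σ x = x → x = inf) ∧ (∀ x, (σ ^ 2) x = x → x = inf) ∧ (∀ x, (σ ^ 83) x = x → x = inf) := by
  obtain ⟨h1, h2, h83⟩ := aut_order166_structure hV A h01 hsymm hdiag hk hsrg σ hσ hσ83 hσ2 hA
  obtain ⟨inf, hinf⟩ := Finset.card_eq_one.mp h1
  have hinf_mem : inf ∈ univ.filter fun x => σ x = x := by rw [hinf]; exact Finset.mem_singleton_self _
  have hσinf : σ inf = inf := (Finset.mem_filter.mp hinf_mem).2
  refine ⟨inf, hσinf, fun x hx => ?_, fun x hx => ?_, fun x hx => ?_⟩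
  · exact eq_of_mem_card_one h1 hinf_mem (Finset.mem_filter.mpr ⟨Finset.mem_univ _, hx⟩)
  · exact eq_of_mem_card_one h2 (Finset.mem_filter.mpr ⟨Finset.mem_univ _,
      Equiv.Perm.pow_apply_eq_self_of_apply_eq_self hσinf 2⟩) (Finset.mem_filter.mpr ⟨Finset.mem_univ _, hx⟩)
  · exact eq_of_mem_card_one h83 (Finset.mem_filter.mpr ⟨Finset.mem_univ _,
      Equiv.Perm.pow_apply_eq_self_of_apply_eq_self hσinf 83⟩) (Finset.mem_filter.mpr ⟨Finset.mem_univ _, hx⟩)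

omit [Fintype V] [DecidableEq V] in
/-- periodicity of period `d` with `0 < d < 166` under `σ` with `σ^166 = 1` forces a fixed point of `σ`, `σ²` or `σ⁸³`. -/
theorem perm166_small_period (σ : Equiv.Perm V) (hσ : σ ^ 166 = 1) {x : V} {d : ℕ} (hd0 : 0 < d) (hd : d < 166)
    (hx : (σ ^ d) x = x) : σ x = x ∨ (σ ^ 2) x = x ∨ (σ ^ 83) x = x := by
  have hpd : Function.IsPeriodicPt σ d x := by
    show (⇑σ)^[d] x = x; rw [← Equiv.Perm.coe_pow]; exact hx
  have hp166 : Function.IsPeriodicPt σ 166 x := by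
    show (⇑σ)^[166] x = x; rw [← Equiv.Perm.coe_pow, hσ]; rfl
  have hg := hpd.gcd hp166
  have hgdvd : d.gcd 166 ∣ 166 := Nat.gcd_dvd_right d 166
  have hgle : d.gcd 166 ≤ d := Nat.le_of_dvd hd0 (Nat.gcd_dvd_left d 166)
  have hgmem : d.gcd 166 ∈ Nat.divisors 166 := Nat.mem_divisors.mpr ⟨hgdvd, by norm_num⟩
  rw [show Nat.divisors 166 = {1, 2, 83, 166} by decide] at hgmem
  simp only [Finset.mem_insert, Finset.mem_singleton] at hgmem
  have hfix : ∀ g : ℕ, Function.IsPeriodicPt σ g x → (σ ^ g) x = x := fun g hgp => by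
    have : (⇑σ)^[g] x = x := hgp
    rwa [← Equiv.Perm.coe_pow] at this
  rcases hgmem with h | h | h | h
  · left; have := hfix _ hg; rw [h, pow_one] at this; exact this
  · right; left; have := hfix _ hg; rw [h] at this; exact this
  · right; right; have := hfix _ hg; rw [h] at this; exact this
  · omega

/-- **Every vertex other than `∞` has orbit length `166`**: `k ↦ σ^k x` is injective on `[0, 166)`. -/
theorem aut_order166_period (hV : Fintype.card V = 333) (A : Matrix V V ℤ)
    (h01 : ∀ x y, A x y = 0 ∨ A x y = 1) (hsymm : ∀ x y, A y x = A x y) (hdiag : ∀ x, A x x = 0)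
    (hk : ∀ x, ∑ y, A x y = 166) (hsrg : ∀ x y, ∑ z, A x z * A z y = 83 * (1 + (if x = y then 1 else 0)) - A x y)
    (σ : Equiv.Perm V) (hσ : σ ^ 166 = 1) (hσ83 : σ ^ 83 ≠ 1) (hσ2 : σ ^ 2 ≠ 1) (hA : ∀ x y, A (σ x) (σ y) = A x y)
    {x : V} (hx : σ x ≠ x) : Set.InjOn (fun k => (σ ^ k) x) (Finset.range 166 : Set ℕ) := by
  obtain ⟨inf, hσinf, -, huniq2, huniq83⟩ := aut_order166_fixed_unique hV A h01 hsymm hdiag hk hsrg σ hσ hσ83 hσ2 hA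
  have hxinf : x ≠ inf := fun h => hx (by rw [h]; exact hσinf)
  -- a coincidence σ^k x = σ^l x with k < l < 166 gives period l - k
  intro k hk l hl hkl
  simp only [Finset.coe_range, Set.mem_Iio] at hk hl
  by_contra hne
  have key : ∀ k l : ℕ, k < 166 → l < 166 → k < l → (σ ^ k) x = (σ ^ l) x → False := by
    intro k l hk hl hlt he
    have hd : (σ ^ (l - k)) x = x := by
      have : (σ ^ k) ((σ ^ (l - k)) x) = (σ ^ k) x := by
        rw [← Equiv.Perm.mul_apply, ← pow_add, Nat.add_sub_cancel' hlt.le, ← he]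
      exact (σ ^ k).injective this
    rcases perm166_small_period σ hσ (by omega) (by omega) hd with h | h | h
    · exact hx h
    · exact hxinf (huniq2 x h)
    · exact hxinf (huniq83 x h)
  rcases Nat.lt_or_gt_of_ne hne with h | h
  · exact key k l hk hl h hkl
  · exact key l k hl hk h hkl.symm

/-- **The two regular orbits of an automorphism of order 166 are `N(∞)` and its complement in `V ∖ {∞}`.**  For `x, y ≠ ∞`
on the same side of `∞` (`A ∞ x = A ∞ y`) there is `k < 166` with `σ^k x = y`; and `∞` is the unique fixed vertex. -/
theorem aut_order166_two_orbits (hV : Fintype.card V = 333) (A : Matrix V V ℤ)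
    (h01 : ∀ x y, A x y = 0 ∨ A x y = 1) (hsymm : ∀ x y, A y x = A x y) (hdiag : ∀ x, A x x = 0)
    (hk : ∀ x, ∑ y, A x y = 166) (hsrg : ∀ x y, ∑ z, A x z * A z y = 83 * (1 + (if x = y then 1 else 0)) - A x y)
    (σ : Equiv.Perm V) (hσ : σ ^ 166 = 1) (hσ83 : σ ^ 83 ≠ 1) (hσ2 : σ ^ 2 ≠ 1) (hA : ∀ x y, A (σ x) (σ y) = A x y) :
    ∃ inf : V, σ inf = inf ∧ (∀ x, σ x = x → x = inf) ∧
      ∀ x y, x ≠ inf → y ≠ inf → A inf x = A inf y → ∃ k, k < 166 ∧ (σ ^ k) x = y := by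
  classical
  obtain ⟨inf, hσinf, huniq1, -, -⟩ := aut_order166_fixed_unique hV A h01 hsymm hdiag hk hsrg σ hσ hσ83 hσ2 hA
  refine ⟨inf, hσinf, huniq1, fun x y hx hy hxy => ?_⟩
  have hσx : σ x ≠ x := fun h => hx (huniq1 x h)
  -- the orbit of x: 166 distinct vertices, all ≠ inf, all with the same adjacency to inf
  set O := (Finset.range 166).image (fun k => (σ ^ k) x) with hO
  have hinj := aut_order166_period hV A h01 hsymm hdiag hk hsrg σ hσ hσ83 hσ2 hA hσx
  have hOcard : O.card = 166 := by rw [hO, Finset.card_image_of_injOn hinj, Finset.card_range]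
  have hAk := adj_pow_invariant A σ hA
  have hinfk : ∀ k : ℕ, (σ ^ k) inf = inf := fun k => Equiv.Perm.pow_apply_eq_self_of_apply_eq_self hσinf k
  -- the side of inf containing x: T = {z ≠ inf | A inf z = A inf x}, of size 166
  set T := (univ.erase inf).filter (fun z => A inf z = A inf x) with hT
  have hOT : O ⊆ T := by
    intro z hz
    obtain ⟨k, hkr, rfl⟩ := Finset.mem_image.mp hz
    rw [hT, Finset.mem_filter, Finset.mem_erase]
    refine ⟨⟨fun h => ?_, Finset.mem_univ _⟩, ?_⟩
    · -- σ^k x = inf ⇒ x = inf (apply σ^(166-k))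
      apply hx
      have hk' : k < 166 := Finset.mem_range.mp hkr
      have : (σ ^ (166 - k)) ((σ ^ k) x) = (σ ^ (166 - k)) inf := by rw [h]
      rw [← Equiv.Perm.mul_apply, ← pow_add, hinfk, Nat.sub_add_cancel hk'.le, hσ, Equiv.Perm.one_apply] at this
      exact this
    · conv_lhs => rw [← hinfk k]
      exact hAk k inf x
  -- |T| = 166: T and its complement side partition univ.erase inf (332 vertices), both of size 166 by the degree of inf
  have hTcard : T.card = 166 := by
    have hdeg := hk inf
    -- number of neighbours of inf among univ.erase inf is 166, non-neighbours 166
    have hsplit : ∑ z ∈ univ.erase inf, A inf z = 166 := by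
      have := Finset.sum_erase_add univ (fun z => A inf z) (Finset.mem_univ inf)
      rw [hdiag, add_zero] at this; rw [this]; exact hdeg
    have hN : ((univ.erase inf).filter fun z => A inf z = 1).card = 166 := by
      have e := sum01_eq_card_filter (fun z => A inf z) (h01 inf) (univ.erase inf)
      rw [hsplit] at e; exact_mod_cast e.symm
    have hE : (univ.erase inf).card = 332 := by rw [Finset.card_erase_of_mem (Finset.mem_univ _), Finset.card_univ, hV]
    have hpart := Finset.card_filter_add_card_filter_not (s := univ.erase inf) (fun z => A inf z = 1)
    rw [hN, hE] at hpart
    rcases h01 inf x with e | e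
    · -- T = non-neighbours = filter (¬ A inf z = 1)
      have : T = (univ.erase inf).filter (fun z => ¬ A inf z = 1) := by
        rw [hT]; ext z; simp only [Finset.mem_filter, e]
        constructor
        · rintro ⟨hz, h0⟩; exact ⟨hz, by rw [h0]; norm_num⟩
        · rintro ⟨hz, h1⟩; exact ⟨hz, by rcases h01 inf z with h | h <;> [exact h; exact absurd h h1]⟩
      rw [this]; omega
    · have : T = (univ.erase inf).filter (fun z => A inf z = 1) := by rw [hT, e]
      rw [this]; exact hN
  have hOeqT : O = T := Finset.eq_of_subset_of_card_le hOT (by rw [hOcard, hTcard])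
  have hyT : y ∈ T := by
    rw [hT, Finset.mem_filter, Finset.mem_erase]; exact ⟨⟨hy, Finset.mem_univ _⟩, hxy.symm⟩
  rw [← hOeqT, hO] at hyT
  obtain ⟨k, hk', hky⟩ := Finset.mem_image.mp hyT
  exact ⟨k, Finset.mem_range.mp hk', hky⟩

end order166orbits

end Summit.Ventures.DiscreteObjects.Hadamard
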